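import Summits.QuantumFields.YangMills.Theorems.BalabanUVNodesPortS1PairPertC
import Summits.QuantumFields.YangMills.Theorems.BalabanUVNodesPortS1JacobianHoloSL2
import Literature.MathematicalPhysics.QuantumFieldTheory.Balaban1983to89.Node00.BgRemainderOfRecord

/-!
# Bałaban UV nodes port — S₁ record-format names: the operators of [II] (1.2)–(1.4) AT THE RECORD, read in the port's `su2Gen`-coordinates (R-D2 pins, DEFINED)

Support file for ⟨stmt-QuantumFields-27930⟩ (`stub_FEpolymerActivitiesReg`), LADDER-YM NODE O, def-Y docket item (c4′) = ◆ CRIT-1 g41's R-D2 «operator names»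
and ◇ LENS-1 g18 v27's located residual («`H, G, C, W` are still DATA … until def-Y pins the (1.2)–(1.4) objects»).  PINNED = DEFINED (review seat RR-2 g33's
recommended shape, READ 9): each operator slot of the S3 assembly's `FWPackage` at `s = 1` is given here as an OUTRIGHT DEFINITION «coordinates ∘ record letter ∘ chart»
over the port's coordinate carriers `𝔄 = (FineIdx F K → ℂ)`, `𝔅 = (FluctIdx F k K → ℂ)`, with the record letters of node 00 (def-Y g37, `Node00.BgRemainderOfRecord` and its
imports; every displayed proof `hposb` (flat slot), `hposπ` (slot (c)), `hQ` and every datum `levB, a, εC, Gp, Δ2` an explicit BINDER, exactly as there and as in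
✓`…N07KnitTokensLandauTwo` — never an existential):
* `H₀` of [II] (1.2)∕(1.5) = [15] (129) p.297 ∕ (179) p.306 («`H₀B` is defined as a minimum of the quadratic form ½⟨A′, Δ_aA′⟩ on the subspace L^jηQA′ = B»,
  `Δ_a = Δ + DRD* + Q*aQ`, `G = Δ_a⁻¹`; the minimiser is `GQ*(QGQ*)⁻¹`) ↦ `recordHfw … := coords ∘ H1OfRecordAtBgFlat … ∘ chart : 𝔅 →L[ℂ] 𝔄` — node 00's FLAT-slot
  right inverse of `Q(U₀)` over `laplaceAOfRecord = Δ(U₀) + DRD† + Q†aQ`, letter for letter print's `H₀` (node00-def-RR-2 g33 READ 22, M2).  In print's ALTERNATIVE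
  representation (Sect. F (126)–(136), (143), Sect. G (178)–(182): the functional (74) «with the operator Δ instead of Δ_π», p.297 L17–18; the one [II] is written in,
  p.306 L32) ANY right inverse may serve as the chart's linearizing `h` (p.287: «there are many linearizing transformations … our choice h = H is a convenient one»),
  this one included.  ERRATUM OF RECORD (READ 19∕20, M1): print's (45) p.285 L13–15 displays TWO rows for Sect. C's `H`, `L^jηQ_jHB = B` AND the Landau range
  `RD*HB = 0` (the slice (76) of Sect. D's LANDAU representation); (c4′)'s one-row wording of this bullet is withdrawn;
* `H` of [II] (1.2)'s chart slot «−HD(·)» ∕ (1.3) = [15] (45)'s two-row operator ↦ `recordHfwPi … levB Gp Δ2 a hposπ hQ := coords ∘ H1OfRecordAtBg128 … ∘ chart` at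
  `Δ2 := 0` (slot (b), Hessian `Δ_π = π†Δ(U₀)π`, ✓`hessOpOfRecord128_zero`; its Landau row is lit's (3.124)′ tower ✓`B9Eq3124PiIdentitiesTowerClosed` at its data);
  at the (79) datum `Δ2 = Δ⁽²⁾(H)` the same letter is (103)'s `H₁` = (174)'s `B`-slot operator.  Both pins live in ONE slot currency — `recordHfwOfH`∕`WOfRecordOfH`∕
  `recordWfwOfH`∕`hOpOfCoords` accept either by one substitution (`recordHfw_eq_ofH`, `recordWfwPi`) — and the two letters coincide where `Δ(U₀)` kills the gauge
  modes (`U₀ = 1`: ✓`hessOpOfRecord_one_covDerivL2K`; pure gauges: ✓`hessOpOfRecord_pureGauge_covDerivL2K`); which representation a consumer's (1.2)∕(1.4) rows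
  take is the consumer's displayed choice (F-H, READ 16∕22: do not MIX the Landau letters `𝔊`, `Δ_π`-current with the flat `H₀` in the chart∕`W` slots); both pins
  are definitions;
* `G` of (1.4) = [15] (110)–(111)∕(116) `𝔊 = G₁𝔓*` ↦ `recordGfw … := coords ∘ frakGOfRecordAtBg128 … ∘ chart : 𝔄 →L[ℂ] 𝔄` (SLOT (c), the slot of
  ✓`bgSchemeOfRecord`; the slot-generic letter is ✓`frakGOfRecordAt`);
* `C` of (1.3) = [15] (44) ↦ `recordCfw … := coords ∘ CslOfRecord … ∘ chart : 𝔄 → 𝔅`;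
* `W` (print's `V` of (1.4), its derivative `(δ∕δA′)V`, `V` of [15] (80)) ↦ `recordWfw … := coords ∘ WOfRecordAt … ∘ chart : 𝔄 → 𝔄`;
* `W` WITH THE `H`-SLOT A PARAMETER (◆ CRIT-1 g41 C-3: print [II] p.2 «V(A′) is a nonlinear and nonlocal function depending on H and D(A′) … given by the formula
  (80)», and the decoupling (1.6) puts `s` INTO `V` through `H(s)`) ↦ `WOfRecordOfH … Hop … : Space115Lit → NegSizeLit … 3` on the record carriers (= ✓`WOfRecordAt` with
  its Sect. C slot `H1OfRecordAtBgFlat` replaced by an arbitrary `Hop` of the same type; pin `WOfRecordOfH_pin`, `rfl`), `recordWfwOfH` its coordinate face, and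
  `hOpOfCoords T := chart ∘ T ∘ coords` placing a coordinate operator `T : 𝔅 →ₗ[ℂ] 𝔄` in that slot — so a supplier's decoupled family `s ↦ H(s)` yields print's
  `W_s := W[H(s)]` by ONE substitution, in either currency.
THE INDEX SETS.  Print [15] p.285 (47)–(51): `D(A′)` and the argument of `H` are «configurations on 𝔅_k», `C` takes values where `Q_jA` does ((44)); (110)–(111): `𝔊` acts on
CURRENTS `J + (δ∕δA′)V(·)` on the fine bonds, paired with configurations by `⟨A, J⟩ = Σ_b tr A(b)J(b)` ((27)).  So the assembly's `𝔛` IS `𝔅` and its `𝔜` has the carrier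
of `𝔄` (the record's `NegSizeLit … 3` and `Space115Lit …` are functions on the same bonds; only the norms differ) — no further index data are needed.
CHARTS (§1).  `fineCoordC`∕`fluctCoordC` read `su2Gen`-coordinates (✓`su2CoordC`, left inverse of the charts ✓`fineMatC` ∕ ✓`fluctMatC` by
✓`su2CoordC_sum_smul_su2Gen`); `jetOfFine`, `negLitOfFine`, `negOfFluct` place a matrix field on node 00's lit-side carriers (`JetSup.equiv`∕`NegSup.equiv` are `Equiv.refl`,
the bonds through ✓`bondToLit`), `evLit` (✓, node 00) ∕ `evNegLit` ∕ `evNeg` read them back; the round trips are `rfl`∕`funext`.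
NOTES.  (C1) The coordinate carriers are bare Pi types (sup norm if any): the S3 assembly keeps its `𝔛`, `𝔜` as its OWN normed type parameters and transports these
letters along its charts — no norm is chosen here.  (C2) Whether `C`, `W` preserve the traceless ∕ `A⋆`-real slice is ONE lemma at the record, displayed (not proved) as
the section rows `hCreal`∕`hCtr` of ✓`…N07KnitTokensLandauTwo` — cited, never respelled; the definitions below do not presuppose it (the readers ignore the trace line).
(C3) `W`'s locality is locality GIVEN `H` ([II] p.2 L35–38): no cube-locality row for `W` alone is stated or suggested here; the family `s ↦ WOfRecordOfH … (H s) …` inherits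
whatever decoupling rows a supplier proves for `s ↦ H(s)` through (80)'s local formula in `(A′, H, D(A′))` — a supplier theorem, not claimed.
(β) PROVENANCE: the port's ✓`recordH1 F k K εbg Vk := fderiv ℝ (…) 0` (✓`…K0RecordFormatNamesFluct` §24) is an `ℝ`-derivative of the chart map and carries `fderiv`'s junk
value off its differentiability set; `recordHfw` below is the letter ITSELF (no derivative, no junk).  The bridge `recordH1 = Re-coords ∘ H1OfRecordAtBgFlat ∘ chart` on
the guarded ball is a THEOREM-SIZE statement and is NOT claimed here.
HONEST LABELS.  Definitions and `rfl`-grade faces only; `N = 2`.  NOT asserted: (46) `|HB| ≤ B₀|B|`, [B9] Thms 3.11∕3.12 (the displayed `hposb`∕`hposπ`), `hQ` onto, (117), (98),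
(C-FW)∕(1.11), any locality row — the binders are CARRIED; the values of `C`, `W` are read on the traceless slice (`su2CoordC` ignores the trace line: whether the record
letters preserve the slice is a separate lemma, not claimed).  No estimate of Bałaban is proved here and nothing about the Yang–Mills mass gap.
[cite: Balaban1988RG2Cluster, (1.2)–(1.4), (1.6) p.2; Balaban1985Variational, (44)–(47) p.285, (80) p.290, (110)–(111) p.294]
-/

namespace Summit.QuantumFields.YangMills.Theorems.K0RecordFormatNames

open Literature.MathematicalPhysics.QuantumFieldTheory.Balaban1983to89
open Literature.MathematicalPhysics.QuantumFieldTheory.Balaban1983to89.Node00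
open Literature.MathematicalPhysics.QuantumFieldTheory.Balaban1983to89.T4Continuum (T4Family)
open Literature.MathematicalPhysics.QuantumFieldTheory.Balaban1983to89.B11Eq115Space (JetSup NegSup NegSize)
open Literature.MathematicalPhysics.QuantumFieldTheory.Balaban1983to89.B11Eq103H1Complex (BondL2K SiteL2K)
open Summit.QuantumFields.YangMills.Theorems.BalabanUVNodesPortS1 (su2CoordC su2CoordC_sum_smul_su2Gen su2CoordC_add su2CoordC_smul)
open scoped BigOperators Matrix.Norms.L2Operator InnerProductSpace

noncomputable section

variable (F : T4Family)

/-! ## §24χ  Coordinate readers and the charts onto node 00's lit-side carriers (`N = 2`) -/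

/-- **Complex `su2Gen`-coordinates of a fine matrix field** (the trace line is ignored). [cite: Balaban1985Variational, (103) p.293 (bookkeeping)] -/
def fineCoordC (K : ℕ) (Y : PBond (F.P K) 0 → MatA 2) : FineIdx F K → ℂ := fun p => su2CoordC (Y p.1) p.2

/-- **Complex `su2Gen`-coordinates of a level-`k` matrix field.** [cite: Balaban1987RG1, (2.4) p.266 (bookkeeping)] -/
def fluctCoordC (k K : ℕ) (X : PBond (F.P K) k → MatA 2) : FluctIdx F k K → ℂ := fun q => su2CoordC (X q.1) q.2

variable {F} in
/-- coordinates ∘ chart = id on the fine side. [folklore] -/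
theorem fineCoordC_fineMatC (K : ℕ) (A : FineIdx F K → ℂ) : fineCoordC F K (fineMatC F K A) = A := by
  funext p; exact su2CoordC_sum_smul_su2Gen (fun a => A (p.1, a)) p.2

variable {F} in
/-- coordinates ∘ chart = id on the fluctuation side. [folklore] -/
theorem fluctCoordC_fluctMatC (k K : ℕ) (z : FluctIdx F k K → ℂ) : fluctCoordC F k K (fluctMatC F k K z) = z := by
  funext q; exact su2CoordC_sum_smul_su2Gen (fun a => z (q.1, a)) q.2

/-- The fine chart as a ℂ-linear map. [cite: Balaban1987RG1, (3.10) p.272 (bookkeeping)] -/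
def fineMatL (K : ℕ) : (FineIdx F K → ℂ) →ₗ[ℂ] (PBond (F.P K) 0 → MatA 2) where
  toFun := fineMatC F K
  map_add' A B := by funext b; simp [fineMatC, add_smul, Finset.sum_add_distrib]
  map_smul' c A := by funext b; simp [fineMatC, Finset.smul_sum, smul_smul]

/-- The fluctuation chart as a ℂ-linear map. [cite: Balaban1987RG1, (2.4) p.266 (bookkeeping)] -/
def fluctMatL (k K : ℕ) : (FluctIdx F k K → ℂ) →ₗ[ℂ] (PBond (F.P K) k → MatA 2) where
  toFun := fluctMatC F k K
  map_add' z w := by funext b; simp [fluctMatC, add_smul, Finset.sum_add_distrib]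
  map_smul' c z := by funext b; simp [fluctMatC, Finset.smul_sum, smul_smul]

/-- The fine coordinate reader as a ℂ-linear map. [folklore] -/
def fineCoordL (K : ℕ) : (PBond (F.P K) 0 → MatA 2) →ₗ[ℂ] (FineIdx F K → ℂ) where
  toFun := fineCoordC F K
  map_add' Y Z := by funext p; exact su2CoordC_add _ _ _
  map_smul' c Y := by funext p; exact su2CoordC_smul _ _ _

/-- The fluctuation coordinate reader as a ℂ-linear map. [folklore] -/
def fluctCoordL (k K : ℕ) : (PBond (F.P K) k → MatA 2) →ₗ[ℂ] (FluctIdx F k K → ℂ) where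
  toFun := fluctCoordC F k K
  map_add' Y Z := by funext q; exact su2CoordC_add _ _ _
  map_smul' c Y := by funext q; exact su2CoordC_smul _ _ _

variable {K : ℕ} (k : ℕ) (Ω : ℕ → Set (Site (F.P K) 0)) (U₀ : GaugeField (F.P K) 0 (SU 2))

variable (K) in
/-- **A fine matrix field as a point of the record's space (115)** (inverse of node 00's ✓`evLit`). [cite: Balaban1985Variational, (115) p.294 (bookkeeping)] -/
def jetOfFine [Fact (0 < (F.L : ℝ))] [Fact (0 < (F.P K).eta k)] : (PBond (F.P K) 0 → MatA 2) →ₗ[ℂ] Space115Lit F 2 K k Ω U₀ where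
  toFun Y := (JetSup.equiv _ _ _).symm fun a => Y ((bondToLit (F.P K) 0).symm a)
  map_add' _ _ := rfl
  map_smul' _ _ := rfl

variable (K) in
/-- **A fine matrix field as a current of size `|·|_{(−n)}`** on the record's carrier. [cite: Balaban1985Variational, p.286, (117) p.295 (bookkeeping)] -/
def negLitOfFine [Fact (0 < (F.L : ℝ))] [Fact (0 < (F.P K).eta k)] (n : ℕ) : (PBond (F.P K) 0 → MatA 2) →ₗ[ℂ] NegSizeLit F 2 K k Ω n where
  toFun Y := (NegSup.equiv _ _).symm fun a => Y ((bondToLit (F.P K) 0).symm a)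
  map_add' _ _ := rfl
  map_smul' _ _ := rfl

variable (K) in
/-- Reading a current back on the record's fine bonds. [cite: Balaban1985Variational, p.286 (bookkeeping)] -/
def evNegLit [Fact (0 < (F.L : ℝ))] [Fact (0 < (F.P K).eta k)] (n : ℕ) : NegSizeLit F 2 K k Ω n →ₗ[ℂ] (PBond (F.P K) 0 → MatA 2) where
  toFun J b := NegSup.equiv _ _ J (bondToLit (F.P K) 0 b)
  map_add' _ _ := rfl
  map_smul' _ _ := rfl

variable (K) in
/-- **A level-`k` matrix field as `B`-type data of size `|·|_{(0)}`** (block levels `levB`). [cite: Balaban1985Variational, (45) p.285 (bookkeeping)] -/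
def negOfFluct [Fact (0 < (F.L : ℝ))] [Fact (0 < (F.P K).eta k)] (levB : PBond (F.P K) k → ℕ) :
    (PBond (F.P K) k → MatA 2) →ₗ[ℂ] NegSize (F.L : ℝ) ((F.P K).eta k) levB 0 (MatA 2) where
  toFun X := (NegSup.equiv _ _).symm X
  map_add' _ _ := rfl
  map_smul' _ _ := rfl

variable (K) in
/-- Reading `B`-type data back as a level-`k` matrix field. [cite: Balaban1985Variational, (45) p.285 (bookkeeping)] -/
def evNeg [Fact (0 < (F.L : ℝ))] [Fact (0 < (F.P K).eta k)] (levB : PBond (F.P K) k → ℕ) :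
    NegSize (F.L : ℝ) ((F.P K).eta k) levB 0 (MatA 2) →ₗ[ℂ] (PBond (F.P K) k → MatA 2) where
  toFun X := NegSup.equiv _ _ X
  map_add' _ _ := rfl
  map_smul' _ _ := rfl

variable {F k Ω U₀}

/-- `evLit ∘ jetOfFine = id`. [folklore] -/
theorem evLit_jetOfFine [Fact (0 < (F.L : ℝ))] [Fact (0 < (F.P K).eta k)] (Y : PBond (F.P K) 0 → MatA 2) :
    evLit F 2 K k Ω U₀ (jetOfFine F K k Ω U₀ Y) = Y := by
  funext b
  simp only [jetOfFine, LinearMap.coe_mk, AddHom.coe_mk, evLit_apply, Equiv.apply_symm_apply, Equiv.symm_apply_apply]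

/-- `jetOfFine ∘ evLit = id`. [folklore] -/
theorem jetOfFine_evLit [Fact (0 < (F.L : ℝ))] [Fact (0 < (F.P K).eta k)] (A : Space115Lit F 2 K k Ω U₀) :
    jetOfFine F K k Ω U₀ (evLit F 2 K k Ω U₀ A) = A := by
  apply (JetSup.equiv _ _ _).injective
  funext a
  simp only [jetOfFine, LinearMap.coe_mk, AddHom.coe_mk, evLit_apply, Equiv.apply_symm_apply]

/-- `evNegLit ∘ negLitOfFine = id`. [folklore] -/
theorem evNegLit_negLitOfFine [Fact (0 < (F.L : ℝ))] [Fact (0 < (F.P K).eta k)] (n : ℕ) (Y : PBond (F.P K) 0 → MatA 2) :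
    evNegLit F K k Ω n (negLitOfFine F K k Ω n Y) = Y := by
  funext b
  simp only [evNegLit, negLitOfFine, LinearMap.coe_mk, AddHom.coe_mk, Equiv.apply_symm_apply, Equiv.symm_apply_apply]

/-- `evNeg ∘ negOfFluct = id` (`rfl`). [folklore] -/
theorem evNeg_negOfFluct [Fact (0 < (F.L : ℝ))] [Fact (0 < (F.P K).eta k)] (levB : PBond (F.P K) k → ℕ) (X : PBond (F.P K) k → MatA 2) :
    evNeg F K k levB (negOfFluct F K k levB X) = X := rfl

/-! ## §24ψ  The four operators of (1.2)–(1.4) at the record, in coordinates — PINNED = DEFINED; `W` with the `H`-slot a parameter -/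

variable (F k Ω U₀)

variable (K) in
/-- ★ **`H₀` of [II] (1.2)∕(1.5) at the record** = [15] (129)∕(179)'s `H₀` («a minimum of ½⟨A′, Δ_aA′⟩ on L^jηQA′ = B», `GQ*(QGQ*)⁻¹`, `G = Δ_a⁻¹`) = node 00's
flat-slot right inverse of `Q(U₀)` ✓`H1OfRecordAtBgFlat`, in coordinates: `𝔅 →L[ℂ] 𝔄`; `= recordHfwOfH … (H1OfRecordAtBgFlat …)` (`recordHfw_eq_ofH`).  The chart
`H` of (1.2)'s «−HD(·)»∕(1.3) in the LANDAU representation is (45)'s two-row operator = `recordHfwPi … 0 …`; in the alternative representation (126)–(136) any right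
inverse, this one included, serves (p.287).  Name kept from (c4′) (R-D2's `s = 1` pin); the print letter is `H₀`.
[cite: Balaban1988RG2Cluster, (1.2), (1.5) p.2; Balaban1985Variational, (129) p.297, (179) p.306, (45)–(47) p.285] -/
def recordHfw [Fact (0 < (F.L : ℝ))] [Fact (0 < (F.P K).eta k)] [Fact (0 < c0Rec F K k)] [Fact (∀ c, 0 < wBRec F K k c)]
    (levB : PBond (F.P K) k → ℕ) (a : ℝ)
    (hposb : ∀ x, x ≠ 0 → 0 < RCLike.re (inner ℂ x (laplaceAOfRecord F 2 k U₀ (QOfRecord F 2 k U₀) (QflatOfRecord F 2 k) a x)))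
    (hQ : Function.Surjective (QOfRecord F 2 k U₀)) : (FluctIdx F k K → ℂ) →L[ℂ] (FineIdx F K → ℂ) :=
  LinearMap.toContinuousLinearMap
    (fineCoordL F K ∘ₗ evLit F 2 K k Ω U₀ ∘ₗ (H1OfRecordAtBgFlat F 2 K k Ω U₀ levB a hposb hQ).toLinearMap ∘ₗ negOfFluct F K k levB ∘ₗ fluctMatL F k K)

variable (K) in
/-- ★ **`G` of (1.4) at the record** = [15] (110)–(111)'s `𝔊 = G₁𝔓*` at node 00's SLOT (c) — the letter ✓`frakGOfRecordAtBg128` (Hessian `π†(Δ(U₀) + Δ⁽²⁾)π`,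
bond letter `Q(U₀) = QOfRecord`, flat site letter `Q′♭ = QflatOfRecord`; data `G′ =: Gp`, `Δ⁽²⁾ =: Δ2`, `a`, displayed proofs `hpos`, `hQ`; the slot-generic letter is
✓`frakGOfRecordAt`, slot (a) = `Δ2 := 0`), in coordinates: `𝔄 →L[ℂ] 𝔄` (currents and configurations live on the same fine bonds; the `|·|_{(−3)}`- and the
(115)-norm differ, the carrier does not).
[cite: Balaban1988RG2Cluster, (1.4) p.2; Balaban1985Variational, (110)–(111) p.294, (116)–(117) p.295; Balaban1985BackgroundPropagators, (3.128) p.421] -/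
def recordGfw [Fact (0 < (F.L : ℝ))] [Fact (0 < (F.P K).eta k)] [Fact (0 < c0Rec F K k)] [Fact (∀ c, 0 < wBRec F K k c)]
    (Gp : SiteL2K ℂ (F.P K).d (fun _ => (F.P K).sitesPerDir 0) (c0Rec F K k) (WRec 2) →ₗ[ℂ]
      SiteL2K ℂ (F.P K).d (fun _ => (F.P K).sitesPerDir 0) (c0Rec F K k) (WRec 2))
    (Δ2 : BondL2K ℂ (F.P K).d (fun _ => (F.P K).sitesPerDir 0) (c0Rec F K k) (WRec 2) →ₗ[ℂ]
      BondL2K ℂ (F.P K).d (fun _ => (F.P K).sitesPerDir 0) (c0Rec F K k) (WRec 2)) (a : ℝ)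
    (hposπ : ∀ x, x ≠ 0 → 0 < RCLike.re (inner ℂ x (laplaceAOfRecordAt F 2 k U₀ (hessOpOfRecord128 F 2 k U₀ Gp (QflatOfRecord F 2 k) Δ2)
      (QOfRecord F 2 k U₀) (QflatOfRecord F 2 k) a x)))
    (hQ : Function.Surjective (QOfRecord F 2 k U₀)) : (FineIdx F K → ℂ) →L[ℂ] (FineIdx F K → ℂ) :=
  LinearMap.toContinuousLinearMap
    (fineCoordL F K ∘ₗ evLit F 2 K k Ω U₀ ∘ₗ (frakGOfRecordAtBg128 F 2 K k Ω U₀ Gp Δ2 a hposπ hQ).toLinearMap ∘ₗ negLitOfFine F K k Ω 3 ∘ₗ fineMatL F K)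

variable (K) in
/-- ★ **`C` of (1.3) at the record** = [15] (44)'s `C_j` on print's `𝔤ᶜ` slice, node 00's ✓`CslOfRecord`, in coordinates: `𝔄 → 𝔅`.
[cite: Balaban1988RG2Cluster, (1.3) p.2; Balaban1985Variational, (44) p.285] -/
def recordCfw [Fact (0 < (F.L : ℝ))] [Fact (0 < (F.P K).eta k)] (levB : PBond (F.P K) k → ℕ) (A : FineIdx F K → ℂ) : FluctIdx F k K → ℂ :=
  fluctCoordC F k K (evNeg F K k levB (CslOfRecord F 2 K k Ω U₀ levB (jetOfFine F K k Ω U₀ (fineMatC F K A))))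

variable (K) in
/-- ★ **`W` of (1.4) at the record** (print's `V`: its derivative `W = (δ∕δA′)V`, `V` of [15] (80)) = node 00's ✓`WOfRecordAt` (= lit's `B11Eq80Current.W80` with every slot
a letter of record), in coordinates: `𝔄 → 𝔄`. [cite: Balaban1988RG2Cluster, (1.4) p.2; Balaban1985Variational, (80) p.290, (84)–(96) pp.290–292] -/
def recordWfw [Fact (0 < (F.L : ℝ))] [Fact (0 < (F.P K).eta k)] [Fact (0 < c0Rec F K k)] [Fact (∀ c, 0 < wBRec F K k c)]
    (levB : PBond (F.P K) k → ℕ) (a : ℝ)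
    (hposb : ∀ x, x ≠ 0 → 0 < RCLike.re (inner ℂ x (laplaceAOfRecord F 2 k U₀ (QOfRecord F 2 k U₀) (QflatOfRecord F 2 k) a x)))
    (hQ : Function.Surjective (QOfRecord F 2 k U₀)) (εC : ℝ)
    (Gp : SiteL2K ℂ (F.P K).d (fun _ => (F.P K).sitesPerDir 0) (c0Rec F K k) (WRec 2) →ₗ[ℂ]
      SiteL2K ℂ (F.P K).d (fun _ => (F.P K).sitesPerDir 0) (c0Rec F K k) (WRec 2))
    (A : FineIdx F K → ℂ) : FineIdx F K → ℂ :=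
  fineCoordC F K (evNegLit F K k Ω 3 (WOfRecordAt F 2 K k Ω U₀ levB a hposb hQ εC Gp (jetOfFine F K k Ω U₀ (fineMatC F K A))))

variable (K) in
/-- ★ **`W` of (80) at the record WITH THE `H`-SLOT A PARAMETER** (◆ CRIT-1 g41 C-3): ✓`WOfRecordAt` = lit's `B11Eq80Current.W80 ρ τ units H C ε_C J Δπ` with every slot a
letter of record and `H := H1OfRecordAtBgFlat …` (Sect. C's choice); here that ONE slot is an arbitrary operator `Hop` of the same type — the `H`-slot type of `W80` at the
record, `NegSize … levB 0 (MatA 2) →L[ℂ] Space115Lit …` — and every other slot is unchanged (`ρ := rhoRec 2`, `τ := tauRecCLM 2`, `unitsOfRecord F 2 U₀`,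
`C := CslOfRecord … levB`, `ε_C`, `J := JOfRecordAtBg`, `Δπ := DeltaPiCurOfRecord … Gp Q′♭`).  Print [II] (1.6) replaces `H` by the decoupled `H(s)` wherever it occurs,
in particular inside `V` of (1.4): a supplier's family `s ↦ H(s)` of this type gives `W_s := WOfRecordOfH … (H s) …`, and `s = 1` is `WOfRecordOfH_pin` (`rfl`).
HONEST: a definition; no bound ((97)–(98)), no locality or decoupling row, no regime (46) is asserted.
[cite: Balaban1988RG2Cluster, (1.4), (1.6) p.2; Balaban1985Variational, (80) p.290, (84)–(96) pp.290–292] -/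
def WOfRecordOfH [Fact (0 < (F.L : ℝ))] [Fact (0 < (F.P K).eta k)] [Fact (0 < c0Rec F K k)] [Fact (∀ c, 0 < wBRec F K k c)]
    (levB : PBond (F.P K) k → ℕ) (Hop : NegSize (F.L : ℝ) ((F.P K).eta k) levB 0 (MatA 2) →L[ℂ] Space115Lit F 2 K k Ω U₀) (εC : ℝ)
    (Gp : SiteL2K ℂ (F.P K).d (fun _ => (F.P K).sitesPerDir 0) (c0Rec F K k) (WRec 2) →ₗ[ℂ]
      SiteL2K ℂ (F.P K).d (fun _ => (F.P K).sitesPerDir 0) (c0Rec F K k) (WRec 2)) :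
    Space115Lit F 2 K k Ω U₀ → NegSizeLit F 2 K k Ω 3 :=
  B11Eq80Current.W80 (rhoRec 2) (tauRecCLM 2) (unitsOfRecord F 2 U₀) Hop (CslOfRecord F 2 K k Ω U₀ levB) εC (JOfRecordAtBg F 2 K k Ω U₀)
    (DeltaPiCurOfRecord F 2 K k Ω U₀ Gp (QflatOfRecord F 2 k))

variable (K) in
/-- `recordWfwOfH` — the coordinate face of `WOfRecordOfH`: `𝔄 → 𝔄` with the `H`-slot a parameter (`recordWfw` is its value at `Hop := H1OfRecordAtBgFlat …`,
`recordWfw_eq_ofH`). [cite: Balaban1988RG2Cluster, (1.4), (1.6) p.2; Balaban1985Variational, (80) p.290] -/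
def recordWfwOfH [Fact (0 < (F.L : ℝ))] [Fact (0 < (F.P K).eta k)] [Fact (0 < c0Rec F K k)] [Fact (∀ c, 0 < wBRec F K k c)]
    (levB : PBond (F.P K) k → ℕ) (Hop : NegSize (F.L : ℝ) ((F.P K).eta k) levB 0 (MatA 2) →L[ℂ] Space115Lit F 2 K k Ω U₀) (εC : ℝ)
    (Gp : SiteL2K ℂ (F.P K).d (fun _ => (F.P K).sitesPerDir 0) (c0Rec F K k) (WRec 2) →ₗ[ℂ]
      SiteL2K ℂ (F.P K).d (fun _ => (F.P K).sitesPerDir 0) (c0Rec F K k) (WRec 2))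
    (A : FineIdx F K → ℂ) : FineIdx F K → ℂ :=
  fineCoordC F K (evNegLit F K k Ω 3 (WOfRecordOfH F K k Ω U₀ levB Hop εC Gp (jetOfFine F K k Ω U₀ (fineMatC F K A))))

variable (K) in
/-- `hOpOfCoords T := chart ∘ T ∘ coords` — a COORDINATE operator `T : 𝔅 →ₗ[ℂ] 𝔄` (the S3 assembly's currency for `H(s)`) placed in the `H`-slot type of `W80` at the
record (continuous by finite dimension: lit's `NegSup`∕`JetSup` instances).  With it a coordinate family `s ↦ T(s)` gives `W_s := recordWfwOfH … (hOpOfCoords … (T s)) …`.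
(The reverse reading `coords ∘ Hop ∘ chart` of a record operator is `recordHfw`'s shape; the two round trips agree on the traceless slice only — NOTE (C2).)
[cite: Balaban1988RG2Cluster, (1.6) p.2 (bookkeeping); Balaban1985Variational, (45) p.285] -/
def hOpOfCoords [Fact (0 < (F.L : ℝ))] [Fact (0 < (F.P K).eta k)] (levB : PBond (F.P K) k → ℕ) (T : (FluctIdx F k K → ℂ) →ₗ[ℂ] (FineIdx F K → ℂ)) :
    NegSize (F.L : ℝ) ((F.P K).eta k) levB 0 (MatA 2) →L[ℂ] Space115Lit F 2 K k Ω U₀ :=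
  LinearMap.toContinuousLinearMap (jetOfFine F K k Ω U₀ ∘ₗ fineMatL F K ∘ₗ T ∘ₗ fluctCoordL F k K ∘ₗ evNeg F K k levB)

variable (K) in
/-- `recordHfwOfH` — the coordinate face of an ARBITRARY operator `Hop` of the `H`-slot type (`B`-data `|·|₍₀₎` → configurations (115)): `𝔅 →L[ℂ] 𝔄`, mirroring
`recordWfwOfH`; `recordHfw` is its value at the flat-slot letter (`recordHfw_eq_ofH`), `recordHfwPi` its value at the π-slot letter.  With it a consumer's (1.2)∕(1.4)
package receives `H` and `W[H]` in ONE slot currency, and [II] (1.6)'s `H(s)` enters (1.2)'s `H` and (1.4)'s `V` by the same substitution.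
[cite: Balaban1988RG2Cluster, (1.2), (1.6) p.2 (bookkeeping); Balaban1985Variational, (45) p.285] -/
def recordHfwOfH [Fact (0 < (F.L : ℝ))] [Fact (0 < (F.P K).eta k)] [Fact (0 < c0Rec F K k)] [Fact (∀ c, 0 < wBRec F K k c)]
    (levB : PBond (F.P K) k → ℕ) (Hop : NegSize (F.L : ℝ) ((F.P K).eta k) levB 0 (MatA 2) →L[ℂ] Space115Lit F 2 K k Ω U₀) :
    (FluctIdx F k K → ℂ) →L[ℂ] (FineIdx F K → ℂ) :=
  LinearMap.toContinuousLinearMap (fineCoordL F K ∘ₗ evLit F 2 K k Ω U₀ ∘ₗ Hop.toLinearMap ∘ₗ negOfFluct F K k levB ∘ₗ fluctMatL F k K)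

variable (K) in
/-- ★ **`H` of [II] (1.2)'s chart slot ∕ (1.3) at the record, π SLOT** = node 00's ✓`H1OfRecordAtBg128 … levB Gp Δ2 a hposπ hQ` (`G₁Q*(QG₁Q*)⁻¹` for the
Hessian `π†(Δ(U₀) + Δ⁽²⁾)π`, [15] (102)–(103)∕(110)) in coordinates: `𝔅 →L[ℂ] 𝔄`.  At `Δ2 := 0` (slot (b), `Δ_π`, ✓`hessOpOfRecord128_zero`) it is [15] (45)'s `H` —
the operator carrying BOTH displayed rows of (45) (right inverse of `Q(U₀)` and, at its data, the Landau range `RD*HB = 0` of lit's (3.124)′ tower); at the (79) datum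
`Δ2 = Δ⁽²⁾(H)` it is (103)'s `H₁` = (174)'s `B`-slot operator.  Same binders `Gp Δ2 a hposπ hQ` as `recordGfw`.  HONEST: a definition; neither row is asserted here.
[cite: Balaban1988RG2Cluster, (1.2)–(1.3) p.2; Balaban1985Variational, (45) p.285, (76) p.289, (102)–(103) p.293, (174) p.305; Balaban1985BackgroundPropagators, (3.124), (3.128) p.421] -/
def recordHfwPi [Fact (0 < (F.L : ℝ))] [Fact (0 < (F.P K).eta k)] [Fact (0 < c0Rec F K k)] [Fact (∀ c, 0 < wBRec F K k c)]
    (levB : PBond (F.P K) k → ℕ)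
    (Gp : SiteL2K ℂ (F.P K).d (fun _ => (F.P K).sitesPerDir 0) (c0Rec F K k) (WRec 2) →ₗ[ℂ]
      SiteL2K ℂ (F.P K).d (fun _ => (F.P K).sitesPerDir 0) (c0Rec F K k) (WRec 2))
    (Δ2 : BondL2K ℂ (F.P K).d (fun _ => (F.P K).sitesPerDir 0) (c0Rec F K k) (WRec 2) →ₗ[ℂ]
      BondL2K ℂ (F.P K).d (fun _ => (F.P K).sitesPerDir 0) (c0Rec F K k) (WRec 2)) (a : ℝ)
    (hposπ : ∀ x, x ≠ 0 → 0 < RCLike.re (inner ℂ x (laplaceAOfRecordAt F 2 k U₀ (hessOpOfRecord128 F 2 k U₀ Gp (QflatOfRecord F 2 k) Δ2)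
      (QOfRecord F 2 k U₀) (QflatOfRecord F 2 k) a x)))
    (hQ : Function.Surjective (QOfRecord F 2 k U₀)) : (FluctIdx F k K → ℂ) →L[ℂ] (FineIdx F K → ℂ) :=
  recordHfwOfH F K k Ω U₀ levB (H1OfRecordAtBg128 F 2 K k Ω U₀ levB Gp Δ2 a hposπ hQ)

variable (K) in
/-- ★ **`W` of (80)∕(84) at the record with print's π-slot `H` in the `H`-slot**: `recordWfwPi := recordWfwOfH … (H1OfRecordAtBg128 …) εC Gp` — the one substitution
by which a consumer reading [II] (1.2)∕(1.4) as print's identities off the locus where `Δ(U₀)` kills gauge modes takes `W`.  HONEST: a definition; no bound, no row.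
[cite: Balaban1988RG2Cluster, (1.4), (1.6) p.2; Balaban1985Variational, (80) p.290, (84) p.290] -/
def recordWfwPi [Fact (0 < (F.L : ℝ))] [Fact (0 < (F.P K).eta k)] [Fact (0 < c0Rec F K k)] [Fact (∀ c, 0 < wBRec F K k c)]
    (levB : PBond (F.P K) k → ℕ)
    (Gp : SiteL2K ℂ (F.P K).d (fun _ => (F.P K).sitesPerDir 0) (c0Rec F K k) (WRec 2) →ₗ[ℂ]
      SiteL2K ℂ (F.P K).d (fun _ => (F.P K).sitesPerDir 0) (c0Rec F K k) (WRec 2))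
    (Δ2 : BondL2K ℂ (F.P K).d (fun _ => (F.P K).sitesPerDir 0) (c0Rec F K k) (WRec 2) →ₗ[ℂ]
      BondL2K ℂ (F.P K).d (fun _ => (F.P K).sitesPerDir 0) (c0Rec F K k) (WRec 2)) (a : ℝ)
    (hposπ : ∀ x, x ≠ 0 → 0 < RCLike.re (inner ℂ x (laplaceAOfRecordAt F 2 k U₀ (hessOpOfRecord128 F 2 k U₀ Gp (QflatOfRecord F 2 k) Δ2)
      (QOfRecord F 2 k U₀) (QflatOfRecord F 2 k) a x)))
    (hQ : Function.Surjective (QOfRecord F 2 k U₀)) (εC : ℝ) (A : FineIdx F K → ℂ) : FineIdx F K → ℂ :=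
  recordWfwOfH F K k Ω U₀ levB (H1OfRecordAtBg128 F 2 K k Ω U₀ levB Gp Δ2 a hposπ hQ) εC Gp A

/-! ## §24ω  Faces -/

variable {F k Ω U₀}

/-- Unfolding of `recordHfw` on a coordinate vector. [cite: Balaban1985Variational, (45) p.285 (bookkeeping)] -/
theorem recordHfw_apply [Fact (0 < (F.L : ℝ))] [Fact (0 < (F.P K).eta k)] [Fact (0 < c0Rec F K k)] [Fact (∀ c, 0 < wBRec F K k c)]
    (levB : PBond (F.P K) k → ℕ) (a : ℝ)
    (hposb : ∀ x, x ≠ 0 → 0 < RCLike.re (inner ℂ x (laplaceAOfRecord F 2 k U₀ (QOfRecord F 2 k U₀) (QflatOfRecord F 2 k) a x)))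
    (hQ : Function.Surjective (QOfRecord F 2 k U₀)) (z : FluctIdx F k K → ℂ) :
    recordHfw F K k Ω U₀ levB a hposb hQ z =
      fineCoordC F K (evLit F 2 K k Ω U₀ (H1OfRecordAtBgFlat F 2 K k Ω U₀ levB a hposb hQ (negOfFluct F K k levB (fluctMatC F k K z)))) := rfl

/-- `recordHfw` IS `recordHfwOfH` at the flat-slot letter (`rfl`). [cite: Balaban1985Variational, (45) p.285 (bookkeeping)] -/
theorem recordHfw_eq_ofH [Fact (0 < (F.L : ℝ))] [Fact (0 < (F.P K).eta k)] [Fact (0 < c0Rec F K k)] [Fact (∀ c, 0 < wBRec F K k c)]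
    (levB : PBond (F.P K) k → ℕ) (a : ℝ)
    (hposb : ∀ x, x ≠ 0 → 0 < RCLike.re (inner ℂ x (laplaceAOfRecord F 2 k U₀ (QOfRecord F 2 k U₀) (QflatOfRecord F 2 k) a x)))
    (hQ : Function.Surjective (QOfRecord F 2 k U₀)) :
    recordHfw F K k Ω U₀ levB a hposb hQ = recordHfwOfH F K k Ω U₀ levB (H1OfRecordAtBgFlat F 2 K k Ω U₀ levB a hposb hQ) := rfl

/-- Unfolding of `recordHfwPi` on a coordinate vector (`rfl`). [cite: Balaban1985Variational, (45) p.285 (bookkeeping)] -/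
theorem recordHfwPi_apply [Fact (0 < (F.L : ℝ))] [Fact (0 < (F.P K).eta k)] [Fact (0 < c0Rec F K k)] [Fact (∀ c, 0 < wBRec F K k c)]
    (levB : PBond (F.P K) k → ℕ)
    (Gp : SiteL2K ℂ (F.P K).d (fun _ => (F.P K).sitesPerDir 0) (c0Rec F K k) (WRec 2) →ₗ[ℂ]
      SiteL2K ℂ (F.P K).d (fun _ => (F.P K).sitesPerDir 0) (c0Rec F K k) (WRec 2))
    (Δ2 : BondL2K ℂ (F.P K).d (fun _ => (F.P K).sitesPerDir 0) (c0Rec F K k) (WRec 2) →ₗ[ℂ]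
      BondL2K ℂ (F.P K).d (fun _ => (F.P K).sitesPerDir 0) (c0Rec F K k) (WRec 2)) (a : ℝ)
    (hposπ : ∀ x, x ≠ 0 → 0 < RCLike.re (inner ℂ x (laplaceAOfRecordAt F 2 k U₀ (hessOpOfRecord128 F 2 k U₀ Gp (QflatOfRecord F 2 k) Δ2)
      (QOfRecord F 2 k U₀) (QflatOfRecord F 2 k) a x)))
    (hQ : Function.Surjective (QOfRecord F 2 k U₀)) (z : FluctIdx F k K → ℂ) :
    recordHfwPi F K k Ω U₀ levB Gp Δ2 a hposπ hQ z =
      fineCoordC F K (evLit F 2 K k Ω U₀ (H1OfRecordAtBg128 F 2 K k Ω U₀ levB Gp Δ2 a hposπ hQ (negOfFluct F K k levB (fluctMatC F k K z)))) := rfl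

/-- THE `s = 1` PIN of the `H`-slot family: at `Hop := H1OfRecordAtBgFlat …` (Sect. C's `H`), `WOfRecordOfH` IS ✓`WOfRecordAt` (`rfl`).
[cite: Balaban1988RG2Cluster, (1.6) p.2 «for s = 1 we get the previous situation»; Balaban1985Variational, (84) p.290 (bookkeeping)] -/
theorem WOfRecordOfH_pin [Fact (0 < (F.L : ℝ))] [Fact (0 < (F.P K).eta k)] [Fact (0 < c0Rec F K k)] [Fact (∀ c, 0 < wBRec F K k c)]
    (levB : PBond (F.P K) k → ℕ) (a : ℝ)
    (hposb : ∀ x, x ≠ 0 → 0 < RCLike.re (inner ℂ x (laplaceAOfRecord F 2 k U₀ (QOfRecord F 2 k U₀) (QflatOfRecord F 2 k) a x)))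
    (hQ : Function.Surjective (QOfRecord F 2 k U₀)) (εC : ℝ)
    (Gp : SiteL2K ℂ (F.P K).d (fun _ => (F.P K).sitesPerDir 0) (c0Rec F K k) (WRec 2) →ₗ[ℂ]
      SiteL2K ℂ (F.P K).d (fun _ => (F.P K).sitesPerDir 0) (c0Rec F K k) (WRec 2)) :
    WOfRecordOfH F K k Ω U₀ levB (H1OfRecordAtBgFlat F 2 K k Ω U₀ levB a hposb hQ) εC Gp = WOfRecordAt F 2 K k Ω U₀ levB a hposb hQ εC Gp := rfl

/-- The same pin in coordinates: `recordWfw = recordWfwOfH … (H1OfRecordAtBgFlat …) …` (`rfl`). [cite: Balaban1988RG2Cluster, (1.6) p.2 (bookkeeping)] -/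
theorem recordWfw_eq_ofH [Fact (0 < (F.L : ℝ))] [Fact (0 < (F.P K).eta k)] [Fact (0 < c0Rec F K k)] [Fact (∀ c, 0 < wBRec F K k c)]
    (levB : PBond (F.P K) k → ℕ) (a : ℝ)
    (hposb : ∀ x, x ≠ 0 → 0 < RCLike.re (inner ℂ x (laplaceAOfRecord F 2 k U₀ (QOfRecord F 2 k U₀) (QflatOfRecord F 2 k) a x)))
    (hQ : Function.Surjective (QOfRecord F 2 k U₀)) (εC : ℝ)
    (Gp : SiteL2K ℂ (F.P K).d (fun _ => (F.P K).sitesPerDir 0) (c0Rec F K k) (WRec 2) →ₗ[ℂ]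
      SiteL2K ℂ (F.P K).d (fun _ => (F.P K).sitesPerDir 0) (c0Rec F K k) (WRec 2)) :
    recordWfw F K k Ω U₀ levB a hposb hQ εC Gp = recordWfwOfH F K k Ω U₀ levB (H1OfRecordAtBgFlat F 2 K k Ω U₀ levB a hposb hQ) εC Gp := rfl

/-- `hOpOfCoords` unfolded on a block field (`rfl`). [cite: Balaban1985Variational, (45) p.285 (bookkeeping)] -/
theorem hOpOfCoords_apply [Fact (0 < (F.L : ℝ))] [Fact (0 < (F.P K).eta k)] (levB : PBond (F.P K) k → ℕ)
    (T : (FluctIdx F k K → ℂ) →ₗ[ℂ] (FineIdx F K → ℂ)) (X : NegSize (F.L : ℝ) ((F.P K).eta k) levB 0 (MatA 2)) :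
    hOpOfCoords F K k Ω U₀ levB T X = jetOfFine F K k Ω U₀ (fineMatL F K (T (fluctCoordC F k K (evNeg F K k levB X)))) := rfl

/-- `C` at the origin: `recordCfw 0 = 0` under node 00's small-field guard. [cite: Balaban1985Variational, (44) p.285] -/
theorem recordCfw_zero [Fact (0 < (F.L : ℝ))] [Fact (0 < (F.P K).eta k)] (levB : PBond (F.P K) k → ℕ) (hU₀ : SmallBelow (avOfRecord F 2 K) k U₀) :
    recordCfw F K k Ω U₀ levB 0 = 0 := by
  have h0 : fineMatC F K (0 : FineIdx F K → ℂ) = 0 := by funext b; simp [fineMatC]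
  rw [recordCfw, h0, map_zero, CslOfRecord_zero F 2 K k Ω U₀ levB hU₀, map_zero]
  funext q
  obtain ⟨b, i⟩ := q
  fin_cases i <;> simp [fluctCoordC, su2CoordC]

end

end Summit.QuantumFields.YangMills.Theorems.K0RecordFormatNames
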